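import Summits.QuantumFields.YangMills.Theorems.SoloBlindRPCovariance
import HarnessLib

/-!
# The Cauchy–Schwarz inequality of torus reflection positivity for real observables
(solo-QuantumFields-blind, rung D7⁺, part 2)

For the torus Wilson state (`β ≥ 0`, even `L`, continuous matrix model `ρ` of a compact group) and
bounded measurable real positive-time observables `F`, `G`, the reflection-positive form
`B(F, G) = ⟨ΘF · G⟩_{Λ,β}` satisfies the (symmetrised) Schwarz inequality

  `(B(F, G) + B(G, F))² ≤ 4 · B(F, F) · B(G, G)`  (`wilsonExpectation_timeReflect_mul_cauchySchwarz`),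

and hence `B(F, G)² ≤ B(F, F) B(G, G)` whenever `B(F, G) = B(G, F)`
(`wilsonExpectation_timeReflect_mul_sq_le`).  Proof: `F + tG` is positive-time for every real `t`
(checked inline),
so `0 ≤ B(F + tG, F + tG)` is a non-negative quadratic in `t` (`discrim_le_zero`).  This is the input
for the log-convexity of two-point functions along the time axis (transfer-matrix / Källén–Lehmann
structure), here on the finite torus and for all `β ≥ 0`.

References: K. Osterwalder, E. Seiler, Ann. Phys. 110 (1978) 440, §2; E. Seiler, LNP 159 (1982) §2.
[folklore; typed torus statements this unit's]
-/

open MeasureTheory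
open Literature.MathematicalPhysics.QuantumFieldTheory Literature.RepresentationTheory.CompactGroups

noncomputable section

namespace Summit.QuantumFields.YangMills.Theorems.SoloBlind

section CauchySchwarz

variable {d L N : ℕ} [NeZero d] [NeZero L] {G : Type*} [Group G] [TopologicalSpace G]
  [IsTopologicalGroup G] [CompactSpace G] [MeasurableSpace G] [BorelSpace G]
  (ρ : G →* Matrix (Fin N) (Fin N) ℂ)

/-- **Schwarz inequality of torus reflection positivity (symmetrised form).** For `β ≥ 0`, `L`
even and bounded measurable real positive-time observables `F`, `G`:
`(⟨ΘF·G⟩ + ⟨ΘG·F⟩)² ≤ 4 ⟨ΘF·F⟩ ⟨ΘG·G⟩`. -/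
theorem wilsonExpectation_timeReflect_mul_cauchySchwarz (hL : Even L) (hρ : Continuous ρ) {β : ℝ}
    (hβ : 0 ≤ β) {F G' : GaugeConfig d L G → ℝ} (hFm : Measurable F) (hFb : ∃ C : ℝ, ∀ U, |F U| ≤ C)
    (hFpos : IsPositiveTimeObservable F) (hGm : Measurable G') (hGb : ∃ C : ℝ, ∀ U, |G' U| ≤ C)
    (hGpos : IsPositiveTimeObservable G') :
    (wilsonExpectation ρ β (fun U => F U.timeReflect * G' U) +
        wilsonExpectation ρ β (fun U => G' U.timeReflect * F U)) ^ 2 ≤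
      4 * wilsonExpectation ρ β (fun U => F U.timeReflect * F U) *
        wilsonExpectation ρ β (fun U => G' U.timeReflect * G' U) := by
  haveI := isProbabilityMeasure_wilsonMeasure (d := d) (L := L) (G := G) ρ hρ β
  obtain ⟨CF, hCF⟩ := hFb
  obtain ⟨CG, hCG⟩ := hGb
  have hCF0 : 0 ≤ CF := le_trans (abs_nonneg _) (hCF (fun _ => 1))
  have hCG0 : 0 ≤ CG := le_trans (abs_nonneg _) (hCG (fun _ => 1))
  -- the four pairings are integrable
  have hprod : ∀ {A B : GaugeConfig d L G → ℝ} {CA CB : ℝ}, Measurable A → Measurable B →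
      (∀ U, |A U| ≤ CA) → (∀ U, |B U| ≤ CB) → 0 ≤ CA →
      Integrable (fun U => A U.timeReflect * B U) (wilsonMeasure ρ β) := by
    intro A B CA CB hAm hBm hA hB hCA0
    refine Integrable.of_bound ((hAm.comp WilsonRP.measurable_timeReflect).mul hBm).aestronglyMeasurable
      (CA * CB) (ae_of_all _ fun U => ?_)
    rw [Real.norm_eq_abs, abs_mul]
    exact mul_le_mul (hA _) (hB _) (abs_nonneg _) hCA0
  have iFF := hprod hFm hFm hCF hCF hCF0
  have iFG := hprod hFm hGm hCF hCG hCF0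
  have iGF := hprod hGm hFm hCG hCF hCG0
  have iGG := hprod hGm hGm hCG hCG hCG0
  set a := wilsonExpectation ρ β (fun U => F U.timeReflect * F U) with ha
  set b := wilsonExpectation ρ β (fun U => F U.timeReflect * G' U) +
    wilsonExpectation ρ β (fun U => G' U.timeReflect * F U) with hb
  set c := wilsonExpectation ρ β (fun U => G' U.timeReflect * G' U) with hc
  -- non-negativity of the quadratic t ↦ c t² + b t + a
  have hquad : ∀ t : ℝ, 0 ≤ c * (t * t) + b * t + a := by
    intro t
    have hH := wilsonExpectation_centred_timeReflect_mul_nonneg ρ hL hρ hβ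
      (F := fun U => F U + t * G' U) (hFm.add (hGm.const_mul t))
      ⟨CF + |t| * CG, fun U => by
        calc |F U + t * G' U| ≤ |F U| + |t * G' U| := abs_add_le _ _
          _ = |F U| + |t| * |G' U| := by rw [abs_mul]
          _ ≤ CF + |t| * CG := by gcongr; exacts [hCF U, hCG U]⟩
      (fun U V hUV => by simp only [hFpos U V hUV, hGpos U V hUV]) 0
    simp only [sub_zero] at hH
    have hexp : (fun U : GaugeConfig d L G =>
        (F U.timeReflect + t * G' U.timeReflect) * (F U + t * G' U)) =
        fun U => F U.timeReflect * F U + t * (F U.timeReflect * G' U) +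
          t * (G' U.timeReflect * F U) + t * t * (G' U.timeReflect * G' U) := by
      funext U; ring
    unfold wilsonExpectation at hH ha hb hc
    have i2 : Integrable (fun U => t * (F U.timeReflect * G' U)) (wilsonMeasure ρ β) :=
      iFG.const_mul t
    have i3 : Integrable (fun U => t * (G' U.timeReflect * F U)) (wilsonMeasure ρ β) :=
      iGF.const_mul t
    have i4 : Integrable (fun U => t * t * (G' U.timeReflect * G' U)) (wilsonMeasure ρ β) :=
      iGG.const_mul (t * t)
    have i12 : Integrable (fun U => F U.timeReflect * F U + t * (F U.timeReflect * G' U))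
        (wilsonMeasure ρ β) := iFF.add i2
    have i123 : Integrable (fun U => F U.timeReflect * F U + t * (F U.timeReflect * G' U) +
        t * (G' U.timeReflect * F U)) (wilsonMeasure ρ β) := i12.add i3
    rw [hexp, integral_add i123 i4, integral_add i12 i3, integral_add iFF i2, integral_const_mul,
      integral_const_mul, integral_const_mul] at hH
    rw [ha, hb, hc]
    nlinarith [hH]
  have hd := discrim_le_zero hquad
  rw [discrim] at hd
  nlinarith [hd]

/-- **Schwarz inequality, symmetric case**: if `⟨ΘF·G⟩ = ⟨ΘG·F⟩` then `⟨ΘF·G⟩² ≤ ⟨ΘF·F⟩ ⟨ΘG·G⟩`. -/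
theorem wilsonExpectation_timeReflect_mul_sq_le (hL : Even L) (hρ : Continuous ρ) {β : ℝ}
    (hβ : 0 ≤ β) {F G' : GaugeConfig d L G → ℝ} (hFm : Measurable F) (hFb : ∃ C : ℝ, ∀ U, |F U| ≤ C)
    (hFpos : IsPositiveTimeObservable F) (hGm : Measurable G') (hGb : ∃ C : ℝ, ∀ U, |G' U| ≤ C)
    (hGpos : IsPositiveTimeObservable G')
    (hsymm : wilsonExpectation ρ β (fun U => F U.timeReflect * G' U) =
      wilsonExpectation ρ β (fun U => G' U.timeReflect * F U)) :
    (wilsonExpectation ρ β (fun U => F U.timeReflect * G' U)) ^ 2 ≤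
      wilsonExpectation ρ β (fun U => F U.timeReflect * F U) *
        wilsonExpectation ρ β (fun U => G' U.timeReflect * G' U) := by
  have h := wilsonExpectation_timeReflect_mul_cauchySchwarz ρ hL hρ hβ hFm hFb hFpos hGm hGb hGpos
  rw [← hsymm] at h
  nlinarith [h]

end CauchySchwarz

end Summit.QuantumFields.YangMills.Theorems.SoloBlind

end
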